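import Mathlib
import Summits.KontsevichZagierPeriods.KontsevichZagierPeriods.Theorems.SoloInformedSumPieces
import Summits.KontsevichZagierPeriods.KontsevichZagierPeriods.Theorems.SoloInformedWordEnds
import HarnessLib
import HarnessLib.Audit

/-!
# SoloInformed — the hook identities: the garland chart (PROGRAMME LIII, file F5a)

Solo programme `solo-KontsevichZagierPeriods-informed`, session s54.  Dimension
`n = (m + 1) + (i + 1)`: the CHAIN coordinates `x_j = x (castAdd (i+1) j)`, `j ≤ m`, carry an
admissible index `u` of weight `m + 1` (word `ε = ε(u)`, `ε_m = 1`), and the `i + 1` BULLET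
coordinates `y_j = x (natAdd (m+1) j)` hang as a chain `y_0 < y_1 < ⋯ < y_i < x_0` below the top.

The integral side of the hook identity `HOOK(u, i+1)` is
`A = [(0,1)ⁿ ∩ {y_i < x_0} ∩ {y_0 < ⋯ < y_i}, G_u(Q(x)) / ∏_j (1 − y_j)]`.  The substitution
`λ(x) = (x_0, x_0x_1, …, x_0⋯x_m ; y_0, …, y_i)` (prefix products on the chain, the identity on the
bullets) carries it by rule (2) onto the GARLAND representation `[(0,1)ⁿ ∩ P_E, g]`,
`g(t) = (∏_{j ≤ m} ω_{ε_j}(t_j)) · ∏_j ω_1(y_j)`, `P_E` the order polytope of the HOOK POSET `E`: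
the chain `t_m < ⋯ < t_0`, the top bullet `y_i < t_0`, the bullet chain `y_0 < ⋯ < y_i` — Yamamoto's
integral of the 2-poset `μ(u, (1^{i+1}))` of Kaneko–Yamamoto.  Contents (the port of
`SoloInformedSumChart` / the Hoffman chart to several bullets): the poset, the integrand, `λ`, its
triangular Jacobian, injectivity and image.  The pull-back identity, MOVE A and the order-cell
dissection follow in `SoloInformedHookPieces`.

References: S. Yamamoto, arXiv:1405.6499 Thm 1.2; M. Kaneko, S. Yamamoto, arXiv:1605.03117 §4
(integral-series identity); Kontsevich–Zagier 2001 §1.2 rules (1), (2).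
-/

noncomputable section

open MeasureTheory Set MvPolynomial
open Literature.ModelTheory.ExponentialFields Literature.NumberTheory.Transcendental
open Literature.NumberTheory.Transcendental.KZ

namespace Summit.KontsevichZagierPeriods.KontsevichZagierPeriods.Theorems

variable {m i : ℕ}

/-! ## 1. The hook poset -/

/-- The hook poset on `Fin ((m+1)+(i+1))` (pairs `(a, b)` mean `t_a < t_b`): the chain
`(j+1, j)` for `j < m`, the top bullet `(y_i, x_0)`, the bullet chain `(y_j, y_{j+1})`, `j < i`. -/
def soloInformedHookPoset (m i : ℕ) : List (Fin (m + 1 + (i + 1)) × Fin (m + 1 + (i + 1))) :=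
  (List.finRange m).map (fun j => (Fin.castAdd (i + 1) j.succ, Fin.castAdd (i + 1) (Fin.castSucc j))) ++
    (Fin.natAdd (m + 1) (Fin.last i), Fin.castAdd (i + 1) 0) ::
      (List.finRange i).map (fun j => (Fin.natAdd (m + 1) (Fin.castSucc j), Fin.natAdd (m + 1) j.succ))

/-- Membership in the hook order polytope. -/
theorem soloInformed_mem_hookOrderSet {t : Fin (m + 1 + (i + 1)) → ℝ} :
    t ∈ soloInformedOrderSet (soloInformedHookPoset m i) ↔
      (∀ j : Fin m, t (Fin.castAdd (i + 1) j.succ) < t (Fin.castAdd (i + 1) (Fin.castSucc j))) ∧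
        t (Fin.natAdd (m + 1) (Fin.last i)) < t (Fin.castAdd (i + 1) 0) ∧
          ∀ j : Fin i, t (Fin.natAdd (m + 1) (Fin.castSucc j)) < t (Fin.natAdd (m + 1) j.succ) := by
  constructor
  · intro h
    exact ⟨fun j => h _ (List.mem_append_left _ (List.mem_map.2 ⟨j, List.mem_finRange j, rfl⟩)),
      h _ (List.mem_append_right _ (List.mem_cons.2 (Or.inl rfl))),
      fun j => h _ (List.mem_append_right _ (List.mem_cons.2 (Or.inr
        (List.mem_map.2 ⟨j, List.mem_finRange j, rfl⟩))))⟩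
  · rintro ⟨h1, h2, h3⟩ p hp
    rcases List.mem_append.1 hp with hp | hp
    · obtain ⟨j, -, rfl⟩ := List.mem_map.1 hp
      exact h1 j
    · rcases List.mem_cons.1 hp with rfl | hp
      · exact h2
      · obtain ⟨j, -, rfl⟩ := List.mem_map.1 hp
        exact h3 j

/-- The chain condition in terms of values. -/
theorem soloInformed_hookChain_iff {t : Fin (m + 1 + (i + 1)) → ℝ} :
    (∀ j : Fin m, t (Fin.castAdd (i + 1) j.succ) < t (Fin.castAdd (i + 1) (Fin.castSucc j))) ↔
      ∀ a b : Fin (m + 1 + (i + 1)), (a : ℕ) = b + 1 → (a : ℕ) ≤ m → t a < t b := by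
  constructor
  · intro h a b hab ha
    have key := h ⟨b, by omega⟩
    have e1 : Fin.castAdd (i + 1) (Fin.succ (⟨b, by omega⟩ : Fin m)) = a := Fin.ext (by simp; omega)
    have e2 : Fin.castAdd (i + 1) (Fin.castSucc (⟨b, by omega⟩ : Fin m)) = b := Fin.ext (by simp)
    rwa [e1, e2] at key
  · intro h j
    exact h _ _ (by simp) (by simp only [Fin.val_castAdd, Fin.val_succ]; omega)

/-- The hook garland `𝒢 = (0,1)ⁿ ∩ P_E`. -/
def soloInformedHookGarland (m i : ℕ) : Set (Fin (m + 1 + (i + 1)) → ℝ) :=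
  soloInformedOpenCube (m + 1 + (i + 1)) ∩ soloInformedOrderSet (soloInformedHookPoset m i)

/-- `𝒢` is `ℚ`-semialgebraic. -/
theorem soloInformed_isSemialgebraic_hookGarland : IsSemialgebraic ℚ (soloInformedHookGarland m i) :=
  (isSemialgebraic_soloInformedOpenCube _).inter (soloInformed_isSemialgebraic_orderSet _)

/-- `𝒢` is measurable. -/
theorem soloInformed_measurableSet_hookGarland : MeasurableSet (soloInformedHookGarland m i) :=
  (soloInformed_measurableSet_openCube _).inter (soloInformed_measurableSet_orderSet _)

/-- The source domain `(0,1)ⁿ ∩ {y_i < x_0} ∩ {y_0 < ⋯ < y_i}` of the chart. -/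
def soloInformedHookA (m i : ℕ) : Set (Fin (m + 1 + (i + 1)) → ℝ) :=
  soloInformedOpenCube (m + 1 + (i + 1)) ∩
    {x | x (Fin.natAdd (m + 1) (Fin.last i)) < x (Fin.castAdd (i + 1) 0)} ∩
      {x | ∀ j : Fin i, x (Fin.natAdd (m + 1) (Fin.castSucc j)) < x (Fin.natAdd (m + 1) j.succ)}

/-- The source domain is measurable. -/
theorem soloInformed_measurableSet_hookA : MeasurableSet (soloInformedHookA m i) := by
  have h : {x : Fin (m + 1 + (i + 1)) → ℝ |
      ∀ j : Fin i, x (Fin.natAdd (m + 1) (Fin.castSucc j)) < x (Fin.natAdd (m + 1) j.succ)} =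
      ⋂ j : Fin i, {x | x (Fin.natAdd (m + 1) (Fin.castSucc j)) < x (Fin.natAdd (m + 1) j.succ)} := by
    ext x
    simp
  refine ((soloInformed_measurableSet_openCube _).inter
    (measurableSet_lt (measurable_pi_apply _) (measurable_pi_apply _))).inter ?_
  rw [h]
  exact MeasurableSet.iInter fun j => measurableSet_lt (measurable_pi_apply _) (measurable_pi_apply _)

/-! ## 2. The garland integrand -/

/-- The letters: the word of `u` on the chain, `1` on every bullet. -/
def soloInformedHookEps (u : List ℕ) (m i : ℕ) : Fin (m + 1 + (i + 1)) → Bool :=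
  Fin.append (soloInformedWordFn u m) (fun _ : Fin (i + 1) => true)

/-- Auxiliary (hook chart): the letter of a chain coordinate. -/
@[simp] theorem soloInformedHookEps_castAdd (u : List ℕ) (j : Fin (m + 1)) :
    soloInformedHookEps u m i (Fin.castAdd (i + 1) j) = soloInformedWordFn u m j := by
  simp [soloInformedHookEps]

/-- Auxiliary (hook chart): the letter of a bullet. -/
@[simp] theorem soloInformedHookEps_natAdd (u : List ℕ) (j : Fin (i + 1)) :
    soloInformedHookEps u m i (Fin.natAdd (m + 1) j) = true := by
  simp [soloInformedHookEps]

/-- The garland integrand `g(t) = ∏_l ω_{ε_l}(t_l)`. -/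
def soloInformedHookG (u : List ℕ) (m i : ℕ) (t : Fin (m + 1 + (i + 1)) → ℝ) : ℝ :=
  ∏ l, mzvForm (soloInformedHookEps u m i l) (t l)

/-- `g(t) = (∏_{j ≤ m} ω_{ε_j}(t_j)) · ∏_j 1/(1 − y_j)`. -/
theorem soloInformedHookG_eq (u : List ℕ) (t : Fin (m + 1 + (i + 1)) → ℝ) :
    soloInformedHookG u m i t =
      (∏ j : Fin (m + 1), mzvForm (soloInformedWordFn u m j) (t (Fin.castAdd (i + 1) j))) *
        ∏ j : Fin (i + 1), 1 / (1 - t (Fin.natAdd (m + 1) j)) := by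
  unfold soloInformedHookG
  rw [Fin.prod_univ_add]
  simp

/-- The denominator polynomial of `g`. -/
def soloInformedHookDen (u : List ℕ) (m i : ℕ) : MvPolynomial (Fin (m + 1 + (i + 1))) ℚ :=
  ∏ l, if soloInformedHookEps u m i l then 1 - X l else X l

/-- `g = 1 / den`. -/
theorem soloInformedHookG_eq_div (u : List ℕ) (t : Fin (m + 1 + (i + 1)) → ℝ) :
    soloInformedHookG u m i t = 1 / aeval t (soloInformedHookDen u m i) := by
  unfold soloInformedHookG soloInformedHookDen
  rw [map_prod, one_div, ← Finset.prod_inv_distrib]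
  refine Finset.prod_congr rfl fun l _ => ?_
  cases soloInformedHookEps u m i l <;> simp

/-- The denominator is positive on the cube. -/
theorem soloInformed_hookDen_pos (u : List ℕ) {t : Fin (m + 1 + (i + 1)) → ℝ}
    (ht : t ∈ soloInformedOpenCube (m + 1 + (i + 1))) :
    0 < (aeval t (soloInformedHookDen u m i) : ℝ) := by
  rw [soloInformedHookDen, map_prod]
  exact Finset.prod_pos fun l _ => by
    cases soloInformedHookEps u m i l
    · simpa using (ht l).1
    · simpa using (ht l).2

/-! ## 3. The substitution `λ` -/

/-- The components of `λ`: prefix products on the chain, `X_l` on the bullets. -/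
def soloInformedHookLamPoly (m i : ℕ) (l : Fin (m + 1 + (i + 1))) :
    MvPolynomial (Fin (m + 1 + (i + 1))) ℚ :=
  if m < l.1 then X l else soloInformedMonoPoly (m + 1 + (i + 1)) l

/-- `λ`. -/
def soloInformedHookLam (m i : ℕ) : (Fin (m + 1 + (i + 1)) → ℝ) → Fin (m + 1 + (i + 1)) → ℝ :=
  soloInformedPolyMap (soloInformedHookLamPoly m i)

/-- `λ(x)_l = x_0 ⋯ x_l` on the chain. -/
theorem soloInformedHookLam_of_le (x : Fin (m + 1 + (i + 1)) → ℝ) {l : Fin (m + 1 + (i + 1))}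
    (hl : l.1 ≤ m) : soloInformedHookLam m i x l = soloInformedPrefixProd x l := by
  simp [soloInformedHookLam, soloInformedHookLamPoly, not_lt.2 hl, soloInformed_aeval_monoPoly]

/-- `λ(x)_l = x_l` on the bullets. -/
theorem soloInformedHookLam_of_lt (x : Fin (m + 1 + (i + 1)) → ℝ) {l : Fin (m + 1 + (i + 1))}
    (hl : m < l.1) : soloInformedHookLam m i x l = x l := by
  simp [soloInformedHookLam, soloInformedHookLamPoly, hl]

/-- Prefix products at chain coordinates are the prefix products of the chain part. -/
theorem soloInformed_prefixProd_castAdd {A : Type*} [CommMonoid A] (x : Fin (m + 1 + (i + 1)) → A)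
    (j : Fin (m + 1)) :
    soloInformedPrefixProd (fun j' : Fin (m + 1) => x (Fin.castAdd (i + 1) j')) j =
      soloInformedPrefixProd x (Fin.castAdd (i + 1) j) := by
  unfold soloInformedPrefixProd
  have h : Finset.univ.filter (fun l : Fin (m + 1 + (i + 1)) => l ≤ Fin.castAdd (i + 1) j) =
      (Finset.univ.filter (fun j' : Fin (m + 1) => j' ≤ j)).map
        ⟨Fin.castAdd (i + 1), Fin.castAdd_injective _ _⟩ := by
    ext l
    simp only [Finset.mem_filter, Finset.mem_univ, true_and, Finset.mem_map,
      Function.Embedding.coeFn_mk, Fin.le_def, Fin.val_castAdd]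
    constructor
    · intro hl
      exact ⟨⟨l, by omega⟩, by simpa using hl, Fin.ext rfl⟩
    · rintro ⟨j', hj', rfl⟩
      simpa using hj'
  rw [h, Finset.prod_map]
  rfl

/-- The first prefix product is the first coordinate. -/
theorem soloInformed_prefixProd_zero_succ {A : Type*} [CommMonoid A] {n : ℕ} (x : Fin (n + 1) → A) :
    soloInformedPrefixProd x 0 = x 0 := by
  have hs : Finset.univ.filter (fun l : Fin (n + 1) => l ≤ 0) = {0} := by
    ext l
    simp
  rw [soloInformedPrefixProd, hs, Finset.prod_singleton]

/-- `λ(x)` at a chain coordinate. -/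
theorem soloInformedHookLam_castAdd (x : Fin (m + 1 + (i + 1)) → ℝ) (j : Fin (m + 1)) :
    soloInformedHookLam m i x (Fin.castAdd (i + 1) j) =
      soloInformedPrefixProd (fun j' : Fin (m + 1) => x (Fin.castAdd (i + 1) j')) j := by
  rw [soloInformedHookLam_of_le x (by simp; omega), soloInformed_prefixProd_castAdd]

/-- `λ(x)` at a bullet. -/
@[simp] theorem soloInformedHookLam_natAdd (x : Fin (m + 1 + (i + 1)) → ℝ) (j : Fin (i + 1)) :
    soloInformedHookLam m i x (Fin.natAdd (m + 1) j) = x (Fin.natAdd (m + 1) j) :=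
  soloInformedHookLam_of_lt x (by simp only [Fin.val_natAdd]; omega)

/-- Above the diagonal the Jacobian matrix of `λ` vanishes. -/
theorem soloInformed_hookJacMat_of_lt {a b : Fin (m + 1 + (i + 1))} (hab : a < b) :
    soloInformedJacMat (soloInformedHookLamPoly m i) a b = 0 := by
  rw [soloInformedJacMat_apply, soloInformedHookLamPoly]
  split_ifs with h
  · exact pderiv_X_of_ne hab.ne
  · have := soloInformed_jacPoly_kappa_of_lt (m := m + 1 + (i + 1)) hab
    rwa [soloInformedJacMat_apply] at this

/-- The diagonal of the Jacobian matrix of `λ`. -/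
theorem soloInformed_hookJacMat_diag (a : Fin (m + 1 + (i + 1))) :
    soloInformedJacMat (soloInformedHookLamPoly m i) a a =
      if m < a.1 then 1 else ∏ l ∈ Finset.univ.filter (fun l : Fin (m + 1 + (i + 1)) => l < a), X l := by
  rw [soloInformedJacMat_apply, soloInformedHookLamPoly]
  split_ifs with h
  · exact pderiv_X_self _
  · have := soloInformed_jacPoly_kappa_diag (m := m + 1 + (i + 1)) a
    rwa [soloInformedJacMat_apply] at this

/-- `det J_λ = ∏_{j ≤ m} ∏_{l < j} X_l` (lower triangular; the bullets contribute `1`). -/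
theorem soloInformed_det_hookJacMat (m i : ℕ) : (soloInformedJacMat (soloInformedHookLamPoly m i)).det =
    ∏ j : Fin (m + 1),
      ∏ l ∈ Finset.univ.filter (fun l : Fin (m + 1 + (i + 1)) => l < Fin.castAdd (i + 1) j), X l := by
  rw [Matrix.det_of_lowerTriangular _ fun a b hab =>
    soloInformed_hookJacMat_of_lt (OrderDual.toDual_lt_toDual.1 hab), Fin.prod_univ_add]
  have hb : ∏ j : Fin (i + 1), soloInformedJacMat (soloInformedHookLamPoly m i)
      (Fin.natAdd (m + 1) j) (Fin.natAdd (m + 1) j) = 1 :=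
    Finset.prod_eq_one fun j _ => by
      rw [soloInformed_hookJacMat_diag, if_pos (by simp only [Fin.val_natAdd]; omega)]
  rw [hb, mul_one]
  exact Finset.prod_congr rfl fun j _ => by
    rw [soloInformed_hookJacMat_diag, if_neg (by simp only [Fin.val_castAdd]; omega)]

/-- The variables below a chain coordinate are chain coordinates. -/
theorem soloInformed_prod_filter_lt_castAdd {A : Type*} [CommMonoid A] (x : Fin (m + 1 + (i + 1)) → A)
    (j : Fin (m + 1)) :
    ∏ l ∈ Finset.univ.filter (fun l : Fin (m + 1 + (i + 1)) => l < Fin.castAdd (i + 1) j), x l =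
      ∏ j' ∈ Finset.univ.filter (fun j' : Fin (m + 1) => j' < j), x (Fin.castAdd (i + 1) j') := by
  have h : Finset.univ.filter (fun l : Fin (m + 1 + (i + 1)) => l < Fin.castAdd (i + 1) j) =
      (Finset.univ.filter (fun j' : Fin (m + 1) => j' < j)).map
        ⟨Fin.castAdd (i + 1), Fin.castAdd_injective _ _⟩ := by
    ext l
    simp only [Finset.mem_filter, Finset.mem_univ, true_and, Finset.mem_map,
      Function.Embedding.coeFn_mk, Fin.lt_def, Fin.val_castAdd]
    constructor
    · intro hl
      exact ⟨⟨l, by omega⟩, by simpa using hl, Fin.ext rfl⟩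
    · rintro ⟨j', hj', rfl⟩
      simpa using hj'
  rw [h, Finset.prod_map]
  rfl

/-- **`det J_λ(x) = ∏_{j < m} λ(x)_j`.** -/
theorem soloInformed_det_hookLam (x : Fin (m + 1 + (i + 1)) → ℝ) :
    (soloInformedJacCLM (soloInformedHookLamPoly m i) x).det =
      ∏ j : Fin m, soloInformedPrefixProd (fun j' : Fin (m + 1) => x (Fin.castAdd (i + 1) j'))
        (Fin.castSucc j) := by
  rw [soloInformed_det_jacCLM, soloInformed_det_hookJacMat, map_prod, Fin.prod_univ_succ]
  have h0 : Finset.univ.filter (fun l : Fin (m + 1 + (i + 1)) => l < Fin.castAdd (i + 1) 0) = ∅ := by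
    ext l; simp [Fin.lt_def]
  rw [h0, Finset.prod_empty, map_one, one_mul]
  refine Finset.prod_congr rfl fun j _ => ?_
  rw [map_prod, soloInformedPrefixProd]
  simp only [aeval_X]
  rw [soloInformed_prod_filter_lt_castAdd]
  refine Finset.prod_congr ?_ fun _ _ => rfl
  ext j'
  simp only [Finset.mem_filter, Finset.mem_univ, true_and, Fin.lt_def, Fin.le_def, Fin.val_succ,
    Fin.val_castSucc]
  omega

/-- The Jacobian determinant is positive on the cube. -/
theorem soloInformed_det_hookLam_pos {x : Fin (m + 1 + (i + 1)) → ℝ}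
    (hx : x ∈ soloInformedOpenCube (m + 1 + (i + 1))) :
    0 < (soloInformedJacCLM (soloInformedHookLamPoly m i) x).det := by
  rw [soloInformed_det_hookLam]
  exact Finset.prod_pos fun j _ => soloInformed_prefixProd_pos (fun j' => hx _) _

/-- `λ` is injective on the open cube. -/
theorem soloInformed_injOn_hookLam :
    InjOn (soloInformedHookLam m i) (soloInformedOpenCube (m + 1 + (i + 1))) := by
  intro x hx x' _ h
  have hc : (fun j' : Fin (m + 1) => x (Fin.castAdd (i + 1) j')) =
      fun j' : Fin (m + 1) => x' (Fin.castAdd (i + 1) j') :=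
    soloInformed_prefixProd_injective (fun j => (hx _).1.ne') fun j => by
      rw [← soloInformedHookLam_castAdd, ← soloInformedHookLam_castAdd, h]
  funext l
  induction l using Fin.addCases with
  | left j => exact congr_fun hc j
  | right j => rw [← soloInformedHookLam_natAdd x j, ← soloInformedHookLam_natAdd x' j, h]

/-- **`λ((0,1)ⁿ ∩ {y_i < x_0} ∩ {y_0 < ⋯ < y_i}) = 𝒢`.** -/
theorem soloInformed_image_hookLam :
    soloInformedHookLam m i '' soloInformedHookA m i = soloInformedHookGarland m i := by
  refine Subset.antisymm ?_ fun t ht => ?_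
  · rintro _ ⟨x, ⟨⟨hx, htop⟩, hbul⟩, rfl⟩
    have hc := soloInformedOpenCube_subset_cube _ hx
    have hxc : (fun j' : Fin (m + 1) => x (Fin.castAdd (i + 1) j')) ∈ soloInformedOpenCube (m + 1) :=
      fun j' => hx _
    refine ⟨fun l => ?_, soloInformed_mem_hookOrderSet.2 ⟨fun j => ?_, ?_, fun j => ?_⟩⟩
    · by_cases hl : m < l.1
      · rw [soloInformedHookLam_of_lt x hl]; exact hx l
      · rw [soloInformedHookLam_of_le x (not_lt.1 hl)]
        exact ⟨soloInformed_prefixProd_pos hx l, (soloInformed_prefixProd_le_apply hc l).trans_lt (hx l).2⟩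
    · rw [soloInformedHookLam_castAdd, soloInformedHookLam_castAdd]
      exact soloInformed_prefixProd_strictAnti hxc Fin.castSucc_lt_succ
    · rw [soloInformedHookLam_natAdd, soloInformedHookLam_castAdd, soloInformed_prefixProd_zero_succ]
      exact htop
    · rw [soloInformedHookLam_natAdd, soloInformedHookLam_natAdd]
      exact hbul j
  · have hcube := ht.1
    obtain ⟨hchain', htop, hbul⟩ := soloInformed_mem_hookOrderSet.1 ht.2
    have hne : ∀ j' : Fin (m + 1), t (Fin.castAdd (i + 1) j') ≠ 0 := fun j' => (hcube _).1.ne'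
    set x : Fin (m + 1 + (i + 1)) → ℝ := Fin.append
      (soloInformedPrefixInv fun j' : Fin (m + 1) => t (Fin.castAdd (i + 1) j'))
      (fun j : Fin (i + 1) => t (Fin.natAdd (m + 1) j)) with hxdef
    have hxl : ∀ j' : Fin (m + 1), x (Fin.castAdd (i + 1) j') =
        soloInformedPrefixInv (fun j' : Fin (m + 1) => t (Fin.castAdd (i + 1) j')) j' := fun j' => by
      simp [hxdef]
    have hxr : ∀ j : Fin (i + 1), x (Fin.natAdd (m + 1) j) = t (Fin.natAdd (m + 1) j) := fun j => by
      simp [hxdef]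
    have hlam : soloInformedHookLam m i x = t := by
      funext l
      induction l using Fin.addCases with
      | left j' =>
        rw [soloInformedHookLam_castAdd]
        simp only [hxl]
        exact soloInformed_prefixProd_prefixInv _ hne j'
      | right j => rw [soloInformedHookLam_natAdd, hxr]
    refine ⟨x, ⟨⟨fun l => ?_, ?_⟩, fun j => ?_⟩, hlam⟩
    · induction l using Fin.addCases with
      | left j' =>
        rw [hxl, soloInformedPrefixInv]
        split_ifs with h0
        · exact hcube _
        · have hlt : t (Fin.castAdd (i + 1) j') < t (Fin.castAdd (i + 1) ⟨j'.1 - 1, by omega⟩) := by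
            have key := hchain' ⟨j'.1 - 1, by omega⟩
            have e1 : Fin.succ (⟨j'.1 - 1, by omega⟩ : Fin m) = j' := Fin.ext (by simp; omega)
            have e2 : Fin.castSucc (⟨j'.1 - 1, by omega⟩ : Fin m) = ⟨j'.1 - 1, by omega⟩ := Fin.ext (by simp)
            rwa [e1, e2] at key
          exact ⟨div_pos (hcube _).1 (hcube _).1, (div_lt_one (hcube _).1).2 hlt⟩
      | right j => rw [hxr]; exact hcube _
    · show x (Fin.natAdd (m + 1) (Fin.last i)) < x (Fin.castAdd (i + 1) 0)
      rw [hxr, hxl, soloInformedPrefixInv, dif_pos (by simp)]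
      exact htop
    · show x (Fin.natAdd (m + 1) (Fin.castSucc j)) < x (Fin.natAdd (m + 1) j.succ)
      rw [hxr, hxr]
      exact hbul j

end Summit.KontsevichZagierPeriods.KontsevichZagierPeriods.Theorems
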